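import Mathlib
import HarnessLib
import Summits.HubbardSuperconductivity.HubbardSuperconductivity.Theorems.KLProgrammeKLRegimeSplitThermalLayerExt
import Summits.HubbardSuperconductivity.HubbardSuperconductivity.Theorems.KLProgrammeMatsubaraZeroSoundWeightedQuasi

/-!
# Route `KLProgramme` — ENGINE stmt-HubbardSuperconductivity-20437 `KLRegimeEngineV17F2`, row (c) value lane: the same-slice zero-transfer bubble in SCALE FORM with a
# QUASI-LIPSCHITZ insertion (brick 3′-2 of cure (A″) of located «(c)-OUT-COOPER-ANTIPODE», route 3′; cell gate-hubbard-kl, seat hubbard-kl-k3c2-p2 g25)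

WHY.  Sequel of `…MatsubaraZeroSoundWeightedQuasi` (brick 3′-1): the annulus form and the scale form of the zero-transfer slice bubble (`klte_annulus_weighted_bubble_norm_le`,
`klte_slice_bubble_weighted_norm_le`, …ThermalLayerExt §4) with the insertion hypothesis weakened to `‖W e − W 0‖ ≤ L_W|e| + δ_W`.  The defect costs a SCALE-FREE term:
`(2π)⁻¹·4·L_G·δ_W·(4Λ)⁶ ≤ (131072/π)(ℓ + 8M_F)·δ_W` (`L_G ≤ 16(ℓ+8M_F)/Λ⁶`) — on route 3′ `δ_W ∝ (K_g + L_c)/L` and the term books in the lattice slot `¼Q.CL β n/L`.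
* `klte_annulus_weighted_bubble_norm_le_quasi`;
* **`klte_slice_bubble_weighted_norm_le_quasi`** — `≤ (524288/π)(ℓ+8M_F)·L_W·Λₙ + (131072/π)(ℓ+8M_F)·δ_W + (393216/π)(ℓ+8M_F)·B_W·(π/β)/Λₙ`.
`δ_W = 0` recovers the landed lemmas.  Pure analysis; nothing about the model is asserted.  0 kit · 0 lit.
-/

noncomputable section

namespace Summit.HubbardSuperconductivity.HubbardSuperconductivity.Theorems.KLRegimeSplit

set_option linter.dupNamespace false -- summit = problem name (single-conjunct summit), D-0017

open Real Finset MeasureTheory Complex Literature.MathematicalPhysics.QuantumLattice Literature.Probability.LatticeModels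
open Summit.HubbardSuperconductivity.HubbardSuperconductivity.Theorems.KLProgrammeLegKernels

section SliceBubble

variable {F : ℝ → ℂ} {LF MF ℓ : ℝ} {W : ℝ → ℂ} {LW BW δW : ℝ}

/-- **Annulus form, quasi-Lipschitz insertion**: `klte_annulus_weighted_bubble_norm_le` with `‖W e − W 0‖ ≤ L_W|e| + δ_W`; the bound gains
`(2π)⁻¹·4·(L_F/r₁⁴ + 2M_F/r₁⁶)·δ_W·r₂⁶`. -/
theorem klte_annulus_weighted_bubble_norm_le_quasi {r₁ r₂ : ℝ} (hlip : ∀ s s', ‖F s - F s'‖ ≤ LF * |s - s'|) (hbd : ∀ s, ‖F s‖ ≤ MF)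
    (hin : ∀ s, s ≤ r₁ ^ 2 → F s = 0) (hout : ∀ s, r₂ ^ 2 ≤ s → F s = 0) (hr₁ : 0 < r₁) (hr₂ : 0 < r₂)
    (hW : Continuous W) (hLW : 0 ≤ LW) (hδW : 0 ≤ δW) (hBW : 0 ≤ BW)
    (hWlip : ∀ e : ℝ, |e| < r₂ → ‖W e - W 0‖ ≤ LW * |e| + δW) (hWbd : ∀ e : ℝ, |e| < r₂ → ‖W e‖ ≤ BW)
    {β : ℝ} (hβ : 0 < β) {M : ℕ} (hM : β * r₂ / (2 * Real.pi) + 1 ≤ M) :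
    ‖β⁻¹ • ∑ i : MatsubaraIdx M,
        ∫ e : ℝ, F (matsubaraFreq β M i ^ 2 + e ^ 2) * ((-I * (matsubaraFreq β M i) + e) ^ 2)⁻¹ * W e‖ ≤
      (2 * Real.pi)⁻¹ * (4 * (LF / r₁ ^ 4 + 2 * MF / r₁ ^ 6) * LW * r₂ ^ 7 + 4 * (LF / r₁ ^ 4 + 2 * MF / r₁ ^ 6) * δW * r₂ ^ 6) +
        8 * (LF / r₁ ^ 4 + 2 * MF / r₁ ^ 6) * BW * r₂ ^ 4 * (r₂ + 2 * Real.pi / β) / β := by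
  set G : ℝ → ℂ := fun s => F s / ((s : ℝ) : ℂ) ^ 2 with hG
  have hGlip : ∀ s s', ‖G s - G s'‖ ≤ (LF / r₁ ^ 4 + 2 * MF / r₁ ^ 6) * |s - s'| := fun s s' =>
    klza_div_sq_lipschitz hlip hbd hin hr₁ s s'
  have hGsupp : ∀ s, r₂ ^ 2 ≤ s → G s = 0 := fun s hs => by simp only [hG, hout s hs, zero_div]
  have hconv : ∀ (k₀ e : ℝ), F (k₀ ^ 2 + e ^ 2) * ((-I * k₀ + e) ^ 2)⁻¹ = G (k₀ ^ 2 + e ^ 2) * (I * k₀ + e) ^ 2 := by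
    intro k₀ e
    rw [klzd_integrand_eq G k₀ e]
    congr 1
    simp only [hG]
    by_cases hz : ((k₀ ^ 2 + e ^ 2 : ℝ) : ℂ) = 0
    · have hz' : k₀ ^ 2 + e ^ 2 = 0 := by exact_mod_cast hz
      have hk : k₀ = 0 := by nlinarith [sq_nonneg k₀, sq_nonneg e]
      have he : e = 0 := by nlinarith [sq_nonneg k₀, sq_nonneg e]
      subst hk; subst he
      have : F 0 = 0 := hin 0 (by positivity)
      simp [this]
    · field_simp
  simp_rw [hconv]
  exact klzw_discrete_weighted_bubble_norm_le_quasi hGlip hGsupp hr₂ hW hLW hδW hBW hWlip hWbd hβ hM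

/-- **The same-slice zero-transfer bubble in SCALE FORM with a QUASI-LIPSCHITZ insertion**: `klte_slice_bubble_weighted_norm_le` with
`‖W(e) − W(0)‖ ≤ L_W|e| + δ_W` on `|e| < 4Λₙ`; conclusion
`≤ (524288/π)(ℓ + 8M_F)·L_W·Λₙ + (131072/π)(ℓ + 8M_F)·δ_W + (393216/π)(ℓ + 8M_F)·B_W·(π/β)/Λₙ` — the defect term is SCALE-FREE. -/
theorem klte_slice_bubble_weighted_norm_le_quasi (hMF : 0 ≤ MF) (hlip : ∀ s s', ‖F s - F s'‖ ≤ LF * |s - s'|) (hbd : ∀ s, ‖F s‖ ≤ MF)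
    {n : ℕ} (hLF : LF ≤ ℓ / klScale klE0 n ^ 2)
    (hin : ∀ s, s ≤ (klScale klE0 n / 2) ^ 2 → F s = 0) (hout : ∀ s, (4 * klScale klE0 n) ^ 2 ≤ s → F s = 0)
    (hW : Continuous W) (hLW : 0 ≤ LW) (hδW : 0 ≤ δW) (hBW : 0 ≤ BW)
    (hWlip : ∀ e : ℝ, |e| < 4 * klScale klE0 n → ‖W e - W 0‖ ≤ LW * |e| + δW)
    (hWbd : ∀ e : ℝ, |e| < 4 * klScale klE0 n → ‖W e‖ ≤ BW)
    {β : ℝ} (hβ : klBetaMin ≤ β) (hn : n ≤ nScales β + 1) {M : ℕ}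
    (hM : β * (4 * klScale klE0 n) / (2 * Real.pi) + 1 ≤ M) :
    ‖β⁻¹ • ∑ i : MatsubaraIdx M,
        ∫ e : ℝ, F (matsubaraFreq β M i ^ 2 + e ^ 2) * ((-I * (matsubaraFreq β M i) + e) ^ 2)⁻¹ * W e‖ ≤
      524288 / Real.pi * (ℓ + 8 * MF) * LW * klScale klE0 n + 131072 / Real.pi * (ℓ + 8 * MF) * δW +
        393216 / Real.pi * (ℓ + 8 * MF) * BW * ((Real.pi / β) / klScale klE0 n) := by
  set Λ := klScale klE0 n with hΛdef
  have hΛ : 0 < Λ := klth_klScale_pos n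
  have hβ0 : 0 < β := pos_of_klBetaMin_le hβ
  have h0 := klte_annulus_weighted_bubble_norm_le_quasi hlip hbd hin hout (by positivity : 0 < Λ / 2) (by positivity : 0 < 4 * Λ)
    hW hLW hδW hBW hWlip hWbd hβ0 hM
  refine h0.trans ?_
  have hLG := klte_LG_le (ℓ := ℓ) (MF := MF) hΛ hLF
  have hLF0 : 0 ≤ LF := by
    have := hlip 0 1; have h0' : (0:ℝ) ≤ ‖F 0 - F 1‖ := norm_nonneg _; norm_num at this; linarith
  have hℓ : 0 ≤ ℓ := by
    have : 0 ≤ ℓ / Λ ^ 2 := hLF0.trans hLF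
    rwa [le_div_iff₀ (by positivity), zero_mul] at this
  have hLG0 : 0 ≤ LF / (Λ / 2) ^ 4 + 2 * MF / (Λ / 2) ^ 6 := by positivity
  have hK : 0 ≤ ℓ + 8 * MF := by positivity
  have hmesh : 4 * Λ + 2 * Real.pi / β ≤ 12 * Λ := by
    have := klte_two_pi_div_le_eight_mul_klScale hβ hn
    rw [← hΛdef] at this
    linarith
  have hπ : 0 < 2 * Real.pi := by positivity
  -- first term (zero sound)
  have h1 : (2 * Real.pi)⁻¹ * (4 * (LF / (Λ / 2) ^ 4 + 2 * MF / (Λ / 2) ^ 6) * LW * (4 * Λ) ^ 7) ≤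
      524288 / Real.pi * (ℓ + 8 * MF) * LW * Λ := by
    have hstep : 4 * (LF / (Λ / 2) ^ 4 + 2 * MF / (Λ / 2) ^ 6) * LW * (4 * Λ) ^ 7 ≤
        4 * (16 * (ℓ + 8 * MF) / Λ ^ 6) * LW * (4 * Λ) ^ 7 := by
      have h47 : 0 ≤ (4 * Λ) ^ 7 := by positivity
      exact mul_le_mul_of_nonneg_right (mul_le_mul_of_nonneg_right (mul_le_mul_of_nonneg_left hLG (by norm_num)) hLW) h47
    have heq : 4 * (16 * (ℓ + 8 * MF) / Λ ^ 6) * LW * (4 * Λ) ^ 7 = 1048576 * (ℓ + 8 * MF) * LW * Λ := by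
      field_simp; ring
    rw [heq] at hstep
    calc (2 * Real.pi)⁻¹ * (4 * (LF / (Λ / 2) ^ 4 + 2 * MF / (Λ / 2) ^ 6) * LW * (4 * Λ) ^ 7)
        ≤ (2 * Real.pi)⁻¹ * (1048576 * (ℓ + 8 * MF) * LW * Λ) := mul_le_mul_of_nonneg_left hstep (by positivity)
      _ = 524288 / Real.pi * (ℓ + 8 * MF) * LW * Λ := by field_simp; ring
  -- defect term (scale-free)
  have h1' : (2 * Real.pi)⁻¹ * (4 * (LF / (Λ / 2) ^ 4 + 2 * MF / (Λ / 2) ^ 6) * δW * (4 * Λ) ^ 6) ≤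
      131072 / Real.pi * (ℓ + 8 * MF) * δW := by
    have hstep : 4 * (LF / (Λ / 2) ^ 4 + 2 * MF / (Λ / 2) ^ 6) * δW * (4 * Λ) ^ 6 ≤
        4 * (16 * (ℓ + 8 * MF) / Λ ^ 6) * δW * (4 * Λ) ^ 6 := by
      have h46 : 0 ≤ (4 * Λ) ^ 6 := by positivity
      exact mul_le_mul_of_nonneg_right (mul_le_mul_of_nonneg_right (mul_le_mul_of_nonneg_left hLG (by norm_num)) hδW) h46
    have heq : 4 * (16 * (ℓ + 8 * MF) / Λ ^ 6) * δW * (4 * Λ) ^ 6 = 262144 * (ℓ + 8 * MF) * δW := by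
      field_simp; ring
    rw [heq] at hstep
    calc (2 * Real.pi)⁻¹ * (4 * (LF / (Λ / 2) ^ 4 + 2 * MF / (Λ / 2) ^ 6) * δW * (4 * Λ) ^ 6)
        ≤ (2 * Real.pi)⁻¹ * (262144 * (ℓ + 8 * MF) * δW) := mul_le_mul_of_nonneg_left hstep (by positivity)
      _ = 131072 / Real.pi * (ℓ + 8 * MF) * δW := by field_simp; ring
  -- thermal term
  have h2 : 8 * (LF / (Λ / 2) ^ 4 + 2 * MF / (Λ / 2) ^ 6) * BW * (4 * Λ) ^ 4 * (4 * Λ + 2 * Real.pi / β) / β ≤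
      393216 / Real.pi * (ℓ + 8 * MF) * BW * ((Real.pi / β) / Λ) := by
    have hstep : 8 * (LF / (Λ / 2) ^ 4 + 2 * MF / (Λ / 2) ^ 6) * BW * (4 * Λ) ^ 4 * (4 * Λ + 2 * Real.pi / β) ≤
        8 * (16 * (ℓ + 8 * MF) / Λ ^ 6) * BW * (4 * Λ) ^ 4 * (12 * Λ) := by
      have h44 : 0 ≤ (4 * Λ) ^ 4 := by positivity
      have hm0 : 0 ≤ 4 * Λ + 2 * Real.pi / β := by positivity
      exact mul_le_mul (mul_le_mul_of_nonneg_right (mul_le_mul_of_nonneg_right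
        (mul_le_mul_of_nonneg_left hLG (by norm_num)) hBW) h44) hmesh hm0 (by positivity)
    have heq : 8 * (16 * (ℓ + 8 * MF) / Λ ^ 6) * BW * (4 * Λ) ^ 4 * (12 * Λ) = 393216 * (ℓ + 8 * MF) * BW / Λ := by
      field_simp; ring
    rw [heq] at hstep
    calc 8 * (LF / (Λ / 2) ^ 4 + 2 * MF / (Λ / 2) ^ 6) * BW * (4 * Λ) ^ 4 * (4 * Λ + 2 * Real.pi / β) / β
        ≤ (393216 * (ℓ + 8 * MF) * BW / Λ) / β := div_le_div_of_nonneg_right hstep hβ0.le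
      _ = 393216 / Real.pi * (ℓ + 8 * MF) * BW * ((Real.pi / β) / Λ) := by field_simp
  have hsplit : (2 * Real.pi)⁻¹ * (4 * (LF / (Λ / 2) ^ 4 + 2 * MF / (Λ / 2) ^ 6) * LW * (4 * Λ) ^ 7 +
        4 * (LF / (Λ / 2) ^ 4 + 2 * MF / (Λ / 2) ^ 6) * δW * (4 * Λ) ^ 6) =
      (2 * Real.pi)⁻¹ * (4 * (LF / (Λ / 2) ^ 4 + 2 * MF / (Λ / 2) ^ 6) * LW * (4 * Λ) ^ 7) +
        (2 * Real.pi)⁻¹ * (4 * (LF / (Λ / 2) ^ 4 + 2 * MF / (Λ / 2) ^ 6) * δW * (4 * Λ) ^ 6) := by ring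
  rw [hsplit]
  linarith [h1, h1', h2]

end SliceBubble

end Summit.HubbardSuperconductivity.HubbardSuperconductivity.Theorems.KLRegimeSplit

end
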